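import Literature.NumberTheory.EllipticCurves.TwoIsogenyShaTwoTorsion
import Literature.Algebra.Module.AlternatingPairingParity
import HarnessLib

/-!
# `#Ш(E)[2] ≤ #Ш(E)[φ] · #Ш(E')[φ̂]` (descent via `2`-isogeny: Silverman, *AEC*, X.4.2(a) with III.6.1)

Quantitative sibling of `TwoIsogenyShaTwoTorsion.lean` (which proves the case `Ш(E)[φ] = 0 = Ш(E')[φ̂] ⇒
Ш(E)[2] = 0`). For `V : y² = x³ + ax² + bx` in two-torsion normal form over a number field `K`,
`φ = φ_V : V → V'` the explicit `2`-isogeny and `φ̂` its dual (`φ̂ ∘ φ = [2]`), with the tree's names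
`Ш(V)[φ] = Ш(V) ∩ im Ξ_V` (`range_twoIsogenyTorsorHom_eq_ker_galH1Map`) and
`Ш(V')[φ̂] = ker Ш(φ̂) = Ш(V') ∩ im Ξ_{V'}` (`ker_galH1Map_eq_of_comp_twoIsogeny`):

* `sha_inf_range_twoIsogenyTorsorHom_le` — `Ш(V) ∩ im Ξ_V ≤ Ш(V) ∩ H¹(K, V)[2]` (`2 Ξ = 0`);
* `natCard_sha_inf_torsionBy_two_le_mul` — **`#(Ш(V) ∩ H¹(K,V)[2]) ≤ #(Ш(V) ∩ im Ξ_V) · #(Ш(V') ∩ im Ξ_{V'})`**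
  when both factors are finite: `Ш(φ)` maps `Ш(V)[2]` into `ker Ш(φ̂) = Ш(V') ∩ im Ξ_{V'}` with kernel inside
  `ker Ш(φ) ∩ Ш(V) = Ш(V) ∩ im Ξ_V` — the exact sequence `0 → Ш(V)[φ] → Ш(V)[2] → Ш(V')[φ̂]`;
* `natCard_sha_torsionBy_two_le_mul`, `natCard_sha_inf_range_le_natCard_sha_torsionBy_two` — the same
  bounds in the currency `#Ш(V/K)[2] = Nat.card (Ш(V)[2])` of the tree's corank files
  (`natCard_torsionBy_addSubgroup`; `Ш[2]` is finite by weak Mordell–Weil, `finite_sha_torsionBy_holds`).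

These are the two inequalities by which a complete descent via `2`-isogeny BRACKETS `#Ш(E/K)[2]` when it does
not vanish (used with the Cassels–Tate parity `#Ш[2] = 2^{t_2 + 2m}` to pin it down exactly).

## References

* J. H. Silverman, *The Arithmetic of Elliptic Curves*, 2nd ed., GTM 106 (2009), Thm. III.6.1–6.2,
  Thm. X.4.2(a), Prop. X.4.9, Example X.4.10. [SilvermanAEC2009]
* J. H. Silverman, J. Tate, *Rational Points on Elliptic Curves*, 2nd ed. (2015), §3.6. [SilvermanTate2015]

## Design

Theorems only; no definitions, no named facts; same conventions as `TwoIsogenyShaTwoTorsion.lean`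
(`K : Type u`, deliberate dot-notation extensions in `namespace WeierstrassCurve`).
-/

noncomputable section

open scoped Classical
open scoped AddSubgroup

universe u

namespace WeierstrassCurve

open Literature.NumberTheory.EllipticCurves Literature.Algebra.Module
open _root_.WeierstrassCurve.Affine (SqUnits)

variable {K : Type u} [Field K] [NumberField K] (V : WeierstrassCurve K) [V.IsTwoTorsionNF] [V.IsElliptic]

/-- **`Ш(V)[φ] ⊆ Ш(V)[2]`**: `Ш(V) ∩ im Ξ_V ≤ Ш(V) ∩ H¹(K, V)[2]`, since `2 · Ξ(x) = 0`
(`two_nsmul_twoIsogenyTorsorHom`). [cite: SilvermanAEC2009, Thm. X.4.2(a)] -/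
theorem sha_inf_range_twoIsogenyTorsorHom_le :
    V.sha ⊓ AddMonoidHom.range (G := Additive (SqUnits K)) V.twoIsogenyTorsorHom ≤
      V.sha ⊓ AddSubgroup.torsionBy V.galH1 2 := by
  rintro c hc
  rw [AddSubgroup.mem_inf] at hc ⊢
  obtain ⟨hsha, ⟨x, hx⟩⟩ := hc
  refine ⟨hsha, (AddSubgroup.torsionBy.nsmul_iff (n := 2)).mpr ?_⟩
  rw [← hx]
  exact two_nsmul_twoIsogenyTorsorHom _ x

/-- **`#Ш(V)[2] ≤ #Ш(V)[φ] · #Ш(V')[φ̂]`** — the exact sequence `0 → Ш(V)[φ] → Ш(V)[2] → Ш(V')[φ̂]` in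
cardinalities: for `V` in two-torsion normal form over a number field with `Ш(V) ∩ im Ξ_V` and
`Ш(V') ∩ im Ξ_{V'}` finite, `#(Ш(V) ∩ H¹(K,V)[2]) ≤ #(Ш(V) ∩ im Ξ_V) · #(Ш(V') ∩ im Ξ_{V'})`. Proof: `Ш(φ) = φ_*`
maps `c ∈ Ш(V)` with `2c = 0` to `φ_* c ∈ Ш(V') ∩ ker φ̂_* = Ш(V') ∩ ker (φ_{V'})_* = Ш(V') ∩ im Ξ_{V'}`
(`galH1Map_galH1Map_of_comp_eq_nsmul`, `ker_galH1Map_eq_of_comp_twoIsogeny`,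
`range_twoIsogenyTorsorHom_eq_ker_galH1Map`), and `φ_* c = 0` forces `c ∈ Ш(V) ∩ ker φ_* = Ш(V) ∩ im Ξ_V`.
[cite: SilvermanAEC2009, Thm. X.4.2(a) and Thm. III.6.1(a)] [cite: SilvermanTate2015, §3.6] -/
theorem natCard_sha_inf_torsionBy_two_le_mul
    [hB : Finite ↥(V.sha ⊓ AddMonoidHom.range (G := Additive (SqUnits K)) V.twoIsogenyTorsorHom)]
    [hB' : Finite ↥(V.twoIsogenyCodomain.sha ⊓
      AddMonoidHom.range (G := Additive (SqUnits K)) V.twoIsogenyCodomain.twoIsogenyTorsorHom)] :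
    Nat.card ↥(V.sha ⊓ AddSubgroup.torsionBy V.galH1 2) ≤
      Nat.card ↥(V.sha ⊓ AddMonoidHom.range (G := Additive (SqUnits K)) V.twoIsogenyTorsorHom) *
        Nat.card ↥(V.twoIsogenyCodomain.sha ⊓
          AddMonoidHom.range (G := Additive (SqUnits K)) V.twoIsogenyCodomain.twoIsogenyTorsorHom) := by
  obtain ⟨ψ, hψφ, -⟩ := V.exists_isogeny_comp_twoIsogeny_eq_two
  set A : AddSubgroup V.galH1 := V.sha ⊓ AddSubgroup.torsionBy V.galH1 2 with hA
  set B : AddSubgroup V.galH1 :=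
    V.sha ⊓ AddMonoidHom.range (G := Additive (SqUnits K)) V.twoIsogenyTorsorHom with hBdef
  set B' : AddSubgroup V.twoIsogenyCodomain.galH1 := V.twoIsogenyCodomain.sha ⊓
    AddMonoidHom.range (G := Additive (SqUnits K)) V.twoIsogenyCodomain.twoIsogenyTorsorHom with hB'def
  set φ' : V.galH1 →+ V.twoIsogenyCodomain.galH1 :=
    galH1Map V.twoIsogenyGeomHom (twoIsogenyGeomHom_smul V) with hφ'
  -- `φ_*` maps `A` into `B'`
  have hmap : ∀ c ∈ A, φ' c ∈ B' := by
    intro c hc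
    rw [hA, AddSubgroup.mem_inf] at hc
    obtain ⟨hsha, h2⟩ := hc
    have h2' : 2 • c = 0 := (AddSubgroup.torsionBy.nsmul_iff (n := 2)).mp h2
    refine AddSubgroup.mem_inf.mpr ⟨?_, ?_⟩
    · exact galH1Map_mem_sha V.twoIsogenyGeomHom (twoIsogenyGeomHom_smul V)
        V.twoIsogeny.hasLocalPointsMaps_toAddMonoidHom hsha
    · have hψc : galH1Map ψ.toAddMonoidHom ψ.equivariant (φ' c) = 0 := by
        rw [hφ', galH1Map_galH1Map_of_comp_eq_nsmul V.twoIsogenyGeomHom (twoIsogenyGeomHom_smul V)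
          ψ.toAddMonoidHom ψ.equivariant hψφ c, h2']
      rw [range_twoIsogenyTorsorHom_eq_ker_galH1Map,
        ← ker_galH1Map_eq_of_comp_twoIsogeny ψ.toAddMonoidHom ψ.equivariant (fun P ↦ ?_),
        AddMonoidHom.mem_ker]
      · exact hψc
      · rw [hψφ, ← natCast_zsmul]
  -- the restricted map `f : A → B'`
  let f : ↥A →+ ↥B' :=
    { toFun := fun c ↦ ⟨φ' c, hmap c c.2⟩
      map_zero' := Subtype.ext (by simp)
      map_add' := fun c d ↦ Subtype.ext (by simp) }
  -- its kernel injects into `B`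
  have hker : ∀ c : ↥A, f c = 0 → (c : V.galH1) ∈ B := by
    intro c hc0
    have hφc0 : φ' c = 0 := congrArg Subtype.val hc0
    have hsha : (c : V.galH1) ∈ V.sha := (AddSubgroup.mem_inf.mp c.2).1
    refine AddSubgroup.mem_inf.mpr ⟨hsha, ?_⟩
    rw [range_twoIsogenyTorsorHom_eq_ker_galH1Map, AddMonoidHom.mem_ker]
    exact hφc0
  have h1 : Nat.card ↥A = Nat.card (↥A ⧸ f.ker) * Nat.card ↥f.ker :=
    AddSubgroup.card_eq_card_quotient_mul_card_addSubgroup f.ker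
  have h2 : Nat.card (↥A ⧸ f.ker) ≤ Nat.card ↥B' := by
    rw [Nat.card_congr (QuotientAddGroup.quotientKerEquivRange f).toEquiv]
    exact Nat.card_le_card_of_injective (fun x : f.range ↦ (x : ↥B')) Subtype.val_injective
  have h3 : Nat.card ↥f.ker ≤ Nat.card ↥B := by
    refine Nat.card_le_card_of_injective (fun c : f.ker ↦ (⟨((c : ↥A) : V.galH1), hker c c.2⟩ : ↥B)) ?_
    intro x y hxy
    exact Subtype.ext (Subtype.ext (congrArg (fun z : ↥B ↦ (z : V.galH1)) hxy))
  calc Nat.card ↥A = Nat.card (↥A ⧸ f.ker) * Nat.card ↥f.ker := h1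
    _ ≤ Nat.card ↥B' * Nat.card ↥B := Nat.mul_le_mul h2 h3
    _ = Nat.card ↥B * Nat.card ↥B' := Nat.mul_comm _ _

/-- **`#Ш(V/K)[2] ≤ #Ш(V)[φ] · #Ш(V')[φ̂]`** in the currency `Nat.card (Ш(V)[2])` of the corank files
(`natCard_torsionBy_addSubgroup`: `Ш(V)[2]` and `Ш(V) ∩ H¹(K,V)[2]` have the same elements).
[cite: SilvermanAEC2009, Thm. X.4.2(a) and Thm. III.6.1(a)] -/
theorem natCard_sha_torsionBy_two_le_mul
    [Finite ↥(V.sha ⊓ AddMonoidHom.range (G := Additive (SqUnits K)) V.twoIsogenyTorsorHom)]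
    [Finite ↥(V.twoIsogenyCodomain.sha ⊓
      AddMonoidHom.range (G := Additive (SqUnits K)) V.twoIsogenyCodomain.twoIsogenyTorsorHom)] :
    Nat.card (V.sha[(2 : ℤ)]) ≤
      Nat.card ↥(V.sha ⊓ AddMonoidHom.range (G := Additive (SqUnits K)) V.twoIsogenyTorsorHom) *
        Nat.card ↥(V.twoIsogenyCodomain.sha ⊓
          AddMonoidHom.range (G := Additive (SqUnits K)) V.twoIsogenyCodomain.twoIsogenyTorsorHom) := by
  rw [natCard_torsionBy_addSubgroup V.sha (2 : ℤ)]
  exact V.natCard_sha_inf_torsionBy_two_le_mul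

/-- **`#Ш(V)[φ] ≤ #Ш(V/K)[2]`** in `Nat.card` currency (`Ш[2]` is finite by weak Mordell–Weil,
`finite_sha_torsionBy_holds`). [cite: SilvermanAEC2009, Thm. X.4.2(a)] -/
theorem natCard_sha_inf_range_le_natCard_sha_torsionBy_two :
    Nat.card ↥(V.sha ⊓ AddMonoidHom.range (G := Additive (SqUnits K)) V.twoIsogenyTorsorHom) ≤
      Nat.card (V.sha[(2 : ℤ)]) := by
  haveI : Finite (V.sha[(2 : ℤ)]) := V.finite_sha_torsionBy_holds (2 : ℤ) (by norm_num)
  haveI : Finite ↥(V.sha ⊓ AddSubgroup.torsionBy V.galH1 2) :=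
    Nat.finite_of_card_ne_zero (by
      rw [← natCard_torsionBy_addSubgroup V.sha (2 : ℤ)]; exact Nat.card_pos.ne')
  rw [natCard_torsionBy_addSubgroup V.sha (2 : ℤ)]
  exact Nat.card_le_card_of_injective (AddSubgroup.inclusion V.sha_inf_range_twoIsogenyTorsorHom_le)
    (AddSubgroup.inclusion_injective _)

/-- **The bracket**: `#Ш(V)[φ] ≤ #Ш(V/K)[2] ≤ #Ш(V)[φ] · #Ш(V')[φ̂]` (both bounds together).
[cite: SilvermanAEC2009, Thm. X.4.2(a) and Thm. III.6.1(a)] -/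
theorem natCard_sha_torsionBy_two_mem_Icc
    [Finite ↥(V.sha ⊓ AddMonoidHom.range (G := Additive (SqUnits K)) V.twoIsogenyTorsorHom)]
    [Finite ↥(V.twoIsogenyCodomain.sha ⊓
      AddMonoidHom.range (G := Additive (SqUnits K)) V.twoIsogenyCodomain.twoIsogenyTorsorHom)] :
    Nat.card (V.sha[(2 : ℤ)]) ∈ Set.Icc
      (Nat.card ↥(V.sha ⊓ AddMonoidHom.range (G := Additive (SqUnits K)) V.twoIsogenyTorsorHom))
      (Nat.card ↥(V.sha ⊓ AddMonoidHom.range (G := Additive (SqUnits K)) V.twoIsogenyTorsorHom) *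
        Nat.card ↥(V.twoIsogenyCodomain.sha ⊓
          AddMonoidHom.range (G := Additive (SqUnits K)) V.twoIsogenyCodomain.twoIsogenyTorsorHom)) :=
  ⟨V.natCard_sha_inf_range_le_natCard_sha_torsionBy_two, V.natCard_sha_torsionBy_two_le_mul⟩

end WeierstrassCurve

end
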